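/-
Copyright (c) 2026. All rights reserved.
Released under Apache 2.0 license as described in the file LICENSE.
Authors: solo-Langlands-informed (ideation tier, family 6).
-/
import Literature.NumberTheory.GaloisRepresentations.PAdicHodgeProofs
import Literature.NumberTheory.GaloisRepresentations.AbsGaloisGroup
import Mathlib.RingTheory.Discriminant
import Mathlib.RingTheory.TensorProduct.Free
import Mathlib.LinearAlgebra.Matrix.ToLinearEquiv
import HarnessLib

/-!
# Characters with coefficients: an admissible character has a period at every embedding

Topic `NumberTheory/GaloisRepresentations`; namespace `Literature.NumberTheory.GaloisRepresentations`.
The CONVERSE of the accepted `PeriodRingData.isAdmissible_of_characterPeriods`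
(file `CharacterPeriodsAdmissible`: a character `ψ : Γ_F → E` with coefficients in a finite `E/ℚ_p`
is `𝔅`-admissible as soon as every `ℚ_p`-embedding `j : E → F̄` carries a period).  Here:

* `PeriodRingData.exists_stabilizerPeriod_of_isAdmissible` — **if the `ℚ_p`-linear representation
  `V ≅ E` underlying `ψ` is `𝔅`-admissible (`dim_F D_B(V) = [E : ℚ_p]`), then for every
  `ℚ_p`-embedding `j : E → F̄` there is `z ∈ B ∖ {0}` with `z = ι(j(ψ σ)) · σ(z)` for every
  `σ ∈ Γ_F` with `σ ∘ j = j`** — a `B`-period of the `F̄`-valued character `j ∘ ψ` of the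
  stabiliser of `j`.  Proof (Fontaine 1994, Exp. III Prop. 1.5.2; Conrad 2011, App. B: `D_B(V)` is an
  `F ⊗_{ℚ_p} E`-module computed embedding by embedding): an `F`-basis of `D_B(V)` is `B`-linearly
  independent (injectivity of the comparison map, accepted `PeriodRingData.linearIndependent_of_mem_D`),
  so its coordinate matrix `P` in a `ℚ_p`-basis `e` of `E` has `det P ≠ 0`; the embeddings matrix
  `A_{jk} = ι(j(e_k))` has `det A ≠ 0` (its square is the discriminant); hence every row of `A·Pᵀ`
  has a nonzero entry `z = Σ_k ι(j(e_k)) P_{tk}`, and the invariance of the `t`-th basis vector of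
  `D_B(V)` reads `z = ι(j(ψ σ)) σ(z)` on the stabiliser of `j`.

This is the step "de Rham ⟹ a `B_dR`-period for each embedding" of the proof that de Rham (Hodge–Tate)
characters are locally algebraic (Serre 1968, Ch. III App. A; Tate 1967 §3.3), for an arbitrary
period-ring datum receiving `F̄` equivariantly.  No definitions, no named facts.

## References
* [FontaineAsterisque223III] J.-M. Fontaine, Astérisque 223 (1994), Exp. III §1.5, Prop. 1.5.2.
* [SerreAbelianLadic1968] J.-P. Serre, *Abelian ℓ-adic representations and elliptic curves* (1968), Ch. III, App. A.
* [Conrad2011LiftingGlobal] B. Conrad, *Lifting global representations with local properties* (2011), App. B.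
-/

noncomputable section

open Field Matrix TensorProduct
open scoped MatrixGroups TensorProduct

namespace Literature.NumberTheory.GaloisRepresentations

universe u w w'

section Embeddings

variable {F : Type u} [Field F] {p : ℕ} [Fact p.Prime] [Algebra ℚ_[p] F]

-- Mathlib's own global value of `maxSynthPendingDepth` (see `PeriodRingData.rank_D_le`).
set_option maxSynthPendingDepth 3 in
/-- **An admissible character with coefficients has a period at every embedding.**  Let `𝔅` be a
period-ring datum for `Γ_F` over `ℚ_p` with invariants `F`, `ι : F̄ → B` a `Γ_F`-equivariant ring map
extending `F → B`, `E/ℚ_p` finite, and `ρ` a continuous representation of `Γ_F` on `V ≅ E` (`θ : E ≃ V`)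
on which `σ` acts through multiplication by `ψ(σ) ∈ E`.  If `ρ` is `𝔅`-admissible then for every
`ℚ_p`-embedding `j : E → F̄` there is `z ∈ B`, `z ≠ 0`, with `z = ι(j(ψ σ)) · σ(z)` for all `σ ∈ Γ_F`
with `σ ∘ j = j` (stated pointwise: `σ • j x = j x` for all `x`; this is `absGalEmbComp σ j = j` of the file
`CharacterPeriodsAdmissible`, which is deliberately not imported). [cite: FontaineAsterisque223III, Exp. III §1.5 and Prop. 1.5.2]
[cite: Conrad2011LiftingGlobal, Appendix B] [cite: SerreAbelianLadic1968, Ch. III App. A] -/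
theorem PeriodRingData.exists_stabilizerPeriod_of_isAdmissible
    (𝔅 : PeriodRingData.{u, 0, u, w} (absoluteGaloisGroup F) ℚ_[p] F)
    (ι : AlgebraicClosure F →+* 𝔅.B)
    (hισ : ∀ (σ : absoluteGaloisGroup F) (x : AlgebraicClosure F), σ • ι x = ι (σ • x))
    (hιa : ∀ a : F, ι (algebraMap F (AlgebraicClosure F) a) = algebraMap F 𝔅.B a)
    {E : Type*} [Field E] [Algebra ℚ_[p] E] [FiniteDimensional ℚ_[p] E]
    {V : Type w'} [AddCommGroup V] [Module ℚ_[p] V] [TopologicalSpace V] [FiniteDimensional ℚ_[p] V]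
    (ρ : ContinuousRep (absoluteGaloisGroup F) ℚ_[p] V) (ψ : absoluteGaloisGroup F → E)
    (θ : E ≃ₗ[ℚ_[p]] V) (hρ : ∀ (σ : absoluteGaloisGroup F) (c : E), ρ σ (θ c) = θ (ψ σ * c))
    (hadm : 𝔅.IsAdmissible ρ) (j : E →ₐ[ℚ_[p]] AlgebraicClosure F) :
    ∃ z : 𝔅.B, z ≠ 0 ∧
      ∀ σ : absoluteGaloisGroup F, (∀ x : E, σ • j x = j x) → z = ι (j (ψ σ)) * σ • z := by
  classical
  -- a `ℚ_p`-basis of `E`, the embeddings, and the matrices of `ρ`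
  set m := Module.finrank ℚ_[p] E with hm
  let e : Module.Basis (Fin m) ℚ_[p] E := Module.finBasis ℚ_[p] E
  haveI : Algebra.IsSeparable ℚ_[p] E := Algebra.IsSeparable.of_integral ℚ_[p] E
  have hcard : Fintype.card (Fin m) = Fintype.card (E →ₐ[ℚ_[p]] AlgebraicClosure F) := by
    rw [Fintype.card_fin, AlgHom.card]
  let ε : Fin m ≃ (E →ₐ[ℚ_[p]] AlgebraicClosure F) := Fintype.equivOfCardEq hcard
  let b : Module.Basis (Fin m) ℚ_[p] V := e.map θ
  let R : absoluteGaloisGroup F → Matrix (Fin m) (Fin m) ℚ_[p] := fun σ => Algebra.leftMulMatrix e (ψ σ)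
  have hR : ∀ σ k i, R σ k i = e.repr (ψ σ * e i) k := fun σ k i =>
    Algebra.leftMulMatrix_eq_repr_mul e (ψ σ) k i
  have hbr : ∀ (σ : absoluteGaloisGroup F) (i : Fin m), ρ σ (b i) = ∑ k, R σ k i • b k := by
    intro σ i
    simp only [b, Module.Basis.map_apply, hR]
    rw [hρ]
    conv_lhs => rw [← e.sum_repr (ψ σ * e i)]
    rw [map_sum]
    simp only [map_smul]
  -- `algebraMap ℚ_p B` factors through `ι`
  have hιq : ∀ c : ℚ_[p], algebraMap ℚ_[p] 𝔅.B c = ι (algebraMap ℚ_[p] (AlgebraicClosure F) c) := by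
    intro c
    rw [PeriodRingData.algebraMap_eq, ← hιa, IsScalarTower.algebraMap_apply ℚ_[p] F (AlgebraicClosure F)]
  -- `Σ_k ι(j(e_k)) R(σ)_{kl} = ι(j(ψ σ)) ι(j(e_l))`
  have hstep1 : ∀ (σ : absoluteGaloisGroup F) (l : Fin m),
      ∑ k, ι (j (e k)) * algebraMap ℚ_[p] 𝔅.B (R σ k l) = ι (j (ψ σ)) * ι (j (e l)) := by
    intro σ l
    simp only [hιq, ← map_mul, ← map_sum]
    congr 1
    have h1 : ∑ k, j (e k) * algebraMap ℚ_[p] (AlgebraicClosure F) (R σ k l) =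
        j (∑ k, R σ k l • e k) := by
      rw [map_sum]
      refine Finset.sum_congr rfl fun k _ => ?_
      rw [map_smul, Algebra.smul_def, mul_comm]
    rw [h1]
    have h2 : ∑ k, R σ k l • e k = ψ σ * e l := by
      simp only [hR]
      exact e.sum_repr (ψ σ * e l)
    rw [h2, map_mul]
  -- an `F`-basis of `D_B(V)`; it is `B`-linearly independent
  have hVm : Module.finrank ℚ_[p] V = m := by rw [← θ.finrank_eq]
  have hDm : Module.finrank F (𝔅.D ρ) = m := by rw [hadm, hVm]
  have hmpos : 0 < m := Module.finrank_pos
  haveI : Module.Finite F (𝔅.D ρ) := Module.finite_of_finrank_pos (by rw [hDm]; exact hmpos)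
  let dB : Module.Basis (Fin m) F (𝔅.D ρ) := Module.finBasisOfFinrankEq F (𝔅.D ρ) hDm
  let d : Fin m → 𝔅.B ⊗[ℚ_[p]] V := fun t => (dB t : 𝔅.B ⊗[ℚ_[p]] V)
  have hdD : ∀ t, d t ∈ 𝔅.D ρ := fun t => (dB t).2
  have hdli : LinearIndependent F d :=
    dB.linearIndependent.map' (𝔅.D ρ).subtype (Submodule.ker_subtype _)
  have hdB : LinearIndependent 𝔅.B d := PeriodRingData.linearIndependent_of_mem_D 𝔅 ρ hdD hdli
  -- coordinates in the `B`-basis `1 ⊗ b`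
  let bB : Module.Basis (Fin m) 𝔅.B (𝔅.B ⊗[ℚ_[p]] V) := Algebra.TensorProduct.basis 𝔅.B b
  let P : Matrix (Fin m) (Fin m) 𝔅.B := fun t k => bB.repr (d t) k
  have hdP : ∀ t, d t = ∑ k, P t k • bB k := fun t => (bB.sum_repr (d t)).symm
  have hPdet : P.det ≠ 0 := by
    intro h0
    obtain ⟨c, hc0, hc⟩ := Matrix.exists_vecMul_eq_zero_iff.mpr h0
    apply hc0
    have hsum : ∑ t, c t • d t = 0 := by
      have h1 : ∑ t, c t • d t = ∑ k, (c ᵥ* P) k • bB k := by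
        simp only [hdP, Finset.smul_sum, smul_smul]
        rw [Finset.sum_comm]
        refine Finset.sum_congr rfl fun k _ => ?_
        rw [← Finset.sum_smul]
        rfl
      rw [h1, hc]
      simp
    funext t
    exact Fintype.linearIndependent_iff.mp hdB c hsum t
  -- the embeddings matrix `A_{jk} = ι(ε_j(e_k))`, `det A ≠ 0`
  let M : Matrix (Fin m) (Fin m) (AlgebraicClosure F) :=
    Algebra.embeddingsMatrixReindex ℚ_[p] (AlgebraicClosure F) e ε
  have hMdet : M.det ≠ 0 := by
    intro h0
    have h := Algebra.discr_eq_det_embeddingsMatrixReindex_pow_two ℚ_[p] (AlgebraicClosure F) e ε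
    rw [show Algebra.embeddingsMatrixReindex ℚ_[p] (AlgebraicClosure F) (⇑e) ε = M from rfl, h0,
      zero_pow two_ne_zero, map_eq_zero] at h
    exact Algebra.discr_not_zero_of_basis ℚ_[p] e h
  let A : Matrix (Fin m) (Fin m) 𝔅.B := ι.mapMatrix Mᵀ
  have hA : ∀ i k, A i k = ι (ε i (e k)) := fun i k => rfl
  have hAdet : A.det ≠ 0 := by
    have h : A.det = ι (Mᵀ.det) := (RingHom.map_det ι Mᵀ).symm
    rw [h, Matrix.det_transpose]
    exact (map_ne_zero ι).2 hMdet
  -- the matrix `A · Pᵀ` is invertible, so its `j`-th row has a nonzero entry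
  have hZdet : (A * Pᵀ).det ≠ 0 := by
    rw [Matrix.det_mul, Matrix.det_transpose]
    exact mul_ne_zero hAdet hPdet
  obtain ⟨t, ht⟩ : ∃ t, (A * Pᵀ) (ε.symm j) t ≠ 0 := by
    by_contra h
    push Not at h
    exact hZdet (Matrix.det_eq_zero_of_row_eq_zero (ε.symm j) h)
  have hZ : (A * Pᵀ) (ε.symm j) t = ∑ k, ι (j (e k)) * P t k := by
    rw [Matrix.mul_apply]
    refine Finset.sum_congr rfl fun k _ => ?_
    rw [hA, Equiv.apply_symm_apply, Matrix.transpose_apply]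
  refine ⟨∑ k, ι (j (e k)) * P t k, hZ ▸ ht, fun σ hj => ?_⟩
  -- invariance of `d t`: `P_{ti} = Σ_k R(σ)_{ik} σ(P_{tk})`
  have hinv : ∀ i, P t i = ∑ k, algebraMap ℚ_[p] 𝔅.B (R σ i k) * σ • P t k := by
    have hfix : 𝔅.tensorRep ρ σ (d t) = d t := (PeriodRingData.mem_D_iff 𝔅 ρ (d t)).mp (hdD t) σ
    -- expand both sides in the basis `bB`
    have hlhs : 𝔅.tensorRep ρ σ (d t) =
        ∑ i, (∑ k, algebraMap ℚ_[p] 𝔅.B (R σ i k) * σ • P t k) • bB i := by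
      conv_lhs => rw [hdP t]
      simp only [map_sum, bB, Algebra.TensorProduct.basis_apply]
      have h1 : ∀ k, 𝔅.tensorRep ρ σ (P t k • ((1 : 𝔅.B) ⊗ₜ[ℚ_[p]] b k)) =
          ∑ i, (algebraMap ℚ_[p] 𝔅.B (R σ i k) * σ • P t k) • ((1 : 𝔅.B) ⊗ₜ[ℚ_[p]] b i) := by
        intro k
        rw [← Algebra.TensorProduct.basis_apply, Algebra.TensorProduct.basis_repr_symm_apply', 
          PeriodRingData.tensorRep_apply_tmul, hbr, TensorProduct.tmul_sum]
        refine Finset.sum_congr rfl fun i _ => ?_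
        rw [← Algebra.TensorProduct.basis_apply, Algebra.TensorProduct.basis_repr_symm_apply',
          ← TensorProduct.smul_tmul, Algebra.smul_def]
      simp only [h1]
      rw [Finset.sum_comm]
      refine Finset.sum_congr rfl fun i _ => ?_
      rw [Finset.sum_smul]
    rw [hlhs] at hfix
    have h2 := congrArg bB.equivFun (hfix.trans (hdP t))
    rw [← bB.equivFun_symm_apply, ← bB.equivFun_symm_apply, LinearEquiv.apply_symm_apply,
      LinearEquiv.apply_symm_apply] at h2
    intro i
    exact (congrFun h2 i).symm
  -- conclusion
  have hσz : σ • ∑ k, ι (j (e k)) * P t k = ∑ k, ι (j (e k)) * σ • P t k := by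
    rw [Finset.smul_sum]
    refine Finset.sum_congr rfl fun k _ => ?_
    rw [smul_mul', hισ, hj]
  rw [hσz]
  calc ∑ k, ι (j (e k)) * P t k
      = ∑ k, ι (j (e k)) * ∑ l, algebraMap ℚ_[p] 𝔅.B (R σ k l) * σ • P t l := by
        refine Finset.sum_congr rfl fun k _ => ?_; rw [← hinv k]
    _ = ∑ l, (∑ k, ι (j (e k)) * algebraMap ℚ_[p] 𝔅.B (R σ k l)) * σ • P t l := by
        simp only [Finset.mul_sum, ← mul_assoc]
        rw [Finset.sum_comm]
        simp only [← Finset.sum_mul]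
    _ = ι (j (ψ σ)) * ∑ l, ι (j (e l)) * σ • P t l := by
        simp only [hstep1, mul_assoc, ← Finset.mul_sum]

end Embeddings

end Literature.NumberTheory.GaloisRepresentations
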